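import Mathlib
import Summits.Ventures.HodgeRepro.Tier4.Common.AdelicDefs
import Summits.Ventures.HodgeRepro.Tier4.Common.AdelicPlaces
import Summits.Ventures.HodgeRepro.Tier4.Common.CongruenceAdeles
import Summits.Ventures.HodgeRepro.Tier4.Common.CompactOpenLevel
import Summits.Ventures.HodgeRepro.Tier4.Line4.LineScalars
import Summits.Ventures.HodgeRepro.Tier4.Line4.FinitePlacePositivity
import Summits.Ventures.HodgeRepro.Tier4.Line4.TransporterLocal
import Summits.Ventures.HodgeRepro.Tier4.Line4.LevelIndexBound
import Summits.Ventures.HodgeRepro.Tier4.Line4.RationalDenominator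

/-!
# Tier4/Line4/QadicBounds — `q`-adic bounds at the places above `q`: rational constants, level elements and the
double coset `K(N) γ₀,f K(N)` (the local bridge of P2)

Blind re-derivation cell `pub-hodge-repro`, Tier 4 «prove the step» (README §9–§10), seat t4-L2-p3 (gen 5; plan-4 g5's
ruling S15514, statement S15538).  Tree path `lean/Summits/Ventures/HodgeRepro/Tier4/Line4/QadicBounds.lean`.

* `valued_algebraMap_le_one`, `natSize_eq_one_of_coprime`, `natSize_pow_le_natSize`: an algebraic integer is
  `v`-integral; a natural number coprime to `q` is a `v`-unit at `v ∣ q`; `|D|_v ≥ |q|_v^D` for `D ≠ 0`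
  (`D = q^a D′`, `a ≤ D`);
* **`exists_valued_le_inv_pow`** / **`exists_valued_le_inv_pow_family`**: a rational constant (a finite family of
  them) is bounded by `(|q|_v⁻¹)^c` at EVERY place `v ∣ q` with ONE `c` (L1-p3's RationalDenominator gives an integer
  denominator);
* `map_adMat`, `map_esc`, `finiteComponent_coe_eq`, `map_mat_ofFinPart`: the `v`-component of rational matrices,
  `E′_𝔸`-scalars, adelic unitaries and finite parts;
* `map_sub_one_le_of_mem_levelK`, `map_le_one_of_mem_levelK`: level elements are `≡ 1 (mod N)` and integral at `v`
  (TransporterLocal's `nearMat_finiteComponent_of_mem_levelK`);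
* `vmul_apply_le`, `vadd_apply_le`: entrywise ultrametric bounds over `k_v`;
* **`map_sub_le_of_mem_levelDoubleCoset`**: every `x ∈ K(N) γ₀,f K(N)` is entrywise within `|N|_v · M` of `γ₀` at `v`
  (`M` a bound of `γ₀`'s entries).

No printed input is consumed.  HC_CM is NOT proved by anyone in this repository.
-/

set_option autoImplicit false
noncomputable section
namespace Summit.Ventures.HodgeRepro.Tier4.Line4
open Summit.Ventures.HodgeRepro.Tier4 Summit.Ventures.HodgeRepro.Tier4.Common
  Summit.Ventures.HodgeRepro.Tier4.Line1 NumberField IsDedekindDomain Matrix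
open scoped NumberField Pointwise

section Constants
variable {k : Type} [Field k] [NumberField k]

/-- The `v`-adic size of an algebraic integer is `≤ 1`. -/
theorem valued_algebraMap_le_one (v : HeightOneSpectrum (𝓞 k)) (o : 𝓞 k) :
    Valued.v (algebraMap k (v.adicCompletion k) (o : k)) ≤ 1 := by
  show Valued.v (((o : k) : v.adicCompletion k)) ≤ 1
  rw [HeightOneSpectrum.valuedAdicCompletion_eq_valuation' v (o : k)]
  exact HeightOneSpectrum.valuation_le_one v o

/-- A natural number coprime to `q` is a `v`-unit at every `v ∣ q`. -/
theorem natSize_eq_one_of_coprime (v : HeightOneSpectrum (𝓞 k)) {q : ℕ} (hq : q.Prime) (hqv : (q : 𝓞 k) ∈ v.asIdeal)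
    {D : ℕ} (hD : ¬ q ∣ D) : natSize k v D = 1 := by
  apply natSize_eq_one_of_not_mem v D
  intro hDv
  have hcop : Nat.Coprime q D := (Nat.Prime.coprime_iff_not_dvd hq).2 hD
  have hbez := Int.gcd_eq_gcd_ab (q : ℤ) (D : ℤ)
  have hg : Int.gcd (q : ℤ) (D : ℤ) = 1 := by
    rw [Int.gcd_natCast_natCast]
    exact hcop
  rw [hg] at hbez
  have h1 : (1 : 𝓞 k) ∈ v.asIdeal := by
    have hcast := congrArg (fun z : ℤ => (z : 𝓞 k)) hbez
    simp only [Nat.cast_one, Int.cast_one, Int.cast_add, Int.cast_mul, Int.cast_natCast] at hcast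
    rw [hcast]
    exact v.asIdeal.add_mem (v.asIdeal.mul_mem_right _ hqv) (v.asIdeal.mul_mem_right _ hDv)
  exact v.isPrime.ne_top ((Ideal.eq_top_iff_one _).2 h1)

/-- **`|D|_v ≥ |q|_v^D` for every natural `D ≠ 0` at every `v ∣ q`** (`D = q^a D′` with `a ≤ D` and `D′` a `v`-unit). -/
theorem natSize_pow_le_natSize (v : HeightOneSpectrum (𝓞 k)) {q : ℕ} (hq : q.Prime) (hqv : (q : 𝓞 k) ∈ v.asIdeal)
    {D : ℕ} (hD : D ≠ 0) : natSize k v q ^ D ≤ natSize k v D := by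
  obtain ⟨a, D', hD', hDeq⟩ := Nat.exists_eq_pow_mul_and_not_dvd hD q hq.one_lt.ne'
  have hD'1 : natSize k v D' = 1 := natSize_eq_one_of_coprime v hq hqv hD'
  rw [hDeq, natSize_mul, natSize_pow, hD'1, mul_one]
  have hq1 : natSize k v q ≤ 1 := natSize_le_one k v q
  have hD'pos : 0 < D' := by
    rcases Nat.eq_zero_or_pos D' with h | h
    · rw [h, mul_zero] at hDeq
      exact absurd hDeq hD
    · exact h
  have haD : a ≤ q ^ a * D' :=
    calc a ≤ q ^ a := (Nat.lt_pow_self hq.one_lt).le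
      _ = q ^ a * 1 := (mul_one _).symm
      _ ≤ q ^ a * D' := Nat.mul_le_mul_left _ hD'pos
  exact pow_le_pow_right_of_le_one' hq1 haD

/-- **THE UNIFORM `q`-ADIC BOUND OF A RATIONAL CONSTANT**: for `r ∈ k` there is `c : ℕ` with
`|r|_v ≤ (|q|_v⁻¹)^c` at every place `v ∣ q`. -/
theorem exists_valued_le_inv_pow (q : ℕ) (hq : q.Prime) (r : k) :
    ∃ c : ℕ, ∀ v : HeightOneSpectrum (𝓞 k), (q : 𝓞 k) ∈ v.asIdeal →
      Valued.v (algebraMap k (v.adicCompletion k) r) ≤ (natSize k v q)⁻¹ ^ c := by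
  obtain ⟨D, hD0, o, hDo⟩ := exists_nat_mul_mem_ringOfIntegers r
  refine ⟨D, fun v hqv => ?_⟩
  have hD : Valued.v (algebraMap k (v.adicCompletion k) (D : k)) = natSize k v D := rfl
  have hDne : natSize k v D ≠ 0 := natSize_ne_zero k v hD0
  have hqne : natSize k v q ≠ 0 := natSize_ne_zero k v hq.ne_zero
  have ho : Valued.v (algebraMap k (v.adicCompletion k) (o : k)) ≤ 1 := valued_algebraMap_le_one v o
  have hprod : natSize k v D * Valued.v (algebraMap k (v.adicCompletion k) r) ≤ 1 := by
    rw [← hD, ← map_mul, ← map_mul, hDo]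
    exact ho
  have hpow : natSize k v q ^ D ≤ natSize k v D := natSize_pow_le_natSize v hq hqv hD0
  -- `|r| ≤ |D|⁻¹ ≤ (|q|^D)⁻¹ = (|q|⁻¹)^D`
  have h1 : Valued.v (algebraMap k (v.adicCompletion k) r) ≤ (natSize k v D)⁻¹ := by
    calc Valued.v (algebraMap k (v.adicCompletion k) r)
        = (natSize k v D)⁻¹ * (natSize k v D * Valued.v (algebraMap k (v.adicCompletion k) r)) := by
          rw [← mul_assoc, inv_mul_cancel₀ hDne, one_mul]
      _ ≤ (natSize k v D)⁻¹ * 1 := by gcongr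
      _ = (natSize k v D)⁻¹ := mul_one _
  have hqDne : natSize k v q ^ D ≠ 0 := pow_ne_zero _ hqne
  have h2 : (natSize k v D)⁻¹ ≤ (natSize k v q ^ D)⁻¹ := by
    rw [inv_le_inv₀ (zero_lt_iff.2 hDne) (zero_lt_iff.2 hqDne)]
    exact hpow
  rw [inv_pow]
  exact h1.trans h2

/-- `1 ≤ (|q|_v⁻¹)^c` at `v ∣ q` (indeed at every `v`). -/
theorem one_le_inv_natSize_pow (v : HeightOneSpectrum (𝓞 k)) (q c : ℕ) (hq : q ≠ 0) :
    1 ≤ (natSize k v q)⁻¹ ^ c := by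
  have hqne : natSize k v q ≠ 0 := natSize_ne_zero k v hq
  have h1 : 1 ≤ (natSize k v q)⁻¹ := by
    rw [one_le_inv₀ (zero_lt_iff.2 hqne)]
    exact natSize_le_one k v q
  exact one_le_pow_of_one_le' h1 c

/-- Monotonicity of the bound in the exponent. -/
theorem inv_natSize_pow_le (v : HeightOneSpectrum (𝓞 k)) (q : ℕ) (hq : q ≠ 0) {c c' : ℕ} (h : c ≤ c') :
    (natSize k v q)⁻¹ ^ c ≤ (natSize k v q)⁻¹ ^ c' := by
  have hqne : natSize k v q ≠ 0 := natSize_ne_zero k v hq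
  have h1 : 1 ≤ (natSize k v q)⁻¹ := by
    rw [one_le_inv₀ (zero_lt_iff.2 hqne)]
    exact natSize_le_one k v q
  exact pow_le_pow_right' h1 h

end Constants

section Family
variable {k : Type} [Field k] [NumberField k]

/-- **THE UNIFORM BOUND OF A FINITE FAMILY OF RATIONAL CONSTANTS** at the places above `q`. -/
theorem exists_valued_le_inv_pow_family (q : ℕ) (hq : q.Prime) {ι : Type} [Fintype ι] (f : ι → k) :
    ∃ c : ℕ, ∀ v : HeightOneSpectrum (𝓞 k), (q : 𝓞 k) ∈ v.asIdeal → ∀ i,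
      Valued.v (algebraMap k (v.adicCompletion k) (f i)) ≤ (natSize k v q)⁻¹ ^ c := by
  classical
  choose cf hcf using fun i => exists_valued_le_inv_pow q hq (f i)
  refine ⟨Finset.univ.sup cf, fun v hqv i => ?_⟩
  exact (hcf i v hqv).trans (inv_natSize_pow_le v q hq.ne_zero (Finset.le_sup (Finset.mem_univ i)))

end Family

section Bridge
variable {k : Type} [Field k] [NumberField k] (W : PlaneData k) (v : HeightOneSpectrum (𝓞 k))

/-- The `v`-component of a rational adelic matrix is the rational matrix read in `k_v`. -/
theorem map_adMat (A : Matrix (Fin 4) (Fin 4) k) :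
    (adMat k A).map (adComponentFin k v) = A.map (algebraMap k (v.adicCompletion k)) := by
  ext i j
  rfl

/-- The `v`-component of an `E′_𝔸`-scalar. -/
theorem map_esc (X Y : Ad k) :
    (esc W X Y).map (adComponentFin k v) =
      adComponentFin k v X • (1 : Matrix (Fin 4) (Fin 4) (v.adicCompletion k)) +
        adComponentFin k v Y • W.Ω.map (algebraMap k (v.adicCompletion k)) := by
  ext i j
  simp only [esc, adMat, Matrix.map_apply, Matrix.add_apply, Matrix.smul_apply, smul_eq_mul, Matrix.one_apply,
    map_add, map_mul]
  split_ifs <;> simp [adComponentFin_algebraMap]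

/-- The matrix of the `v`-component of `g` is the entrywise `v`-component of `mat g` (TransporterLocal's
`finiteComponent_coe`, restated). -/
theorem finiteComponent_coe_eq (g : GA W) :
    ((GA.finiteComponent W v g : GL (Fin 4) (v.adicCompletion k)) : Matrix (Fin 4) (Fin 4) (v.adicCompletion k)) =
      (GA.mat W g).map (adComponentFin k v) :=
  finiteComponent_coe W v g

/-- **Level elements are `v`-adically `≡ 1 (mod N)`**, in the matrix-map form. -/
theorem map_sub_one_le_of_mem_levelK {N : ℕ} {a : GA W} (ha : a ∈ levelK W N) (i j : Fin 4) :
    Valued.v (((GA.mat W a).map (adComponentFin k v) - 1) i j) ≤ natSize k v N := by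
  have h := nearMat_finiteComponent_of_mem_levelK W v ha i j
  rw [finiteComponent_coe_eq] at h
  rw [Matrix.sub_apply]
  exact h

/-- Level elements are `v`-integral. -/
theorem map_le_one_of_mem_levelK {N : ℕ} {a : GA W} (ha : a ∈ levelK W N) (i j : Fin 4) :
    Valued.v (((GA.mat W a).map (adComponentFin k v)) i j) ≤ 1 := by
  have h := map_sub_one_le_of_mem_levelK W v ha i j
  have h1 : Valued.v ((1 : Matrix (Fin 4) (Fin 4) (v.adicCompletion k)) i j) ≤ 1 := by
    by_cases hij : i = j
    · subst hij; simp
    · simp [Matrix.one_apply_ne hij]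
  have hN : natSize k v N ≤ 1 := natSize_le_one k v N
  calc Valued.v (((GA.mat W a).map (adComponentFin k v)) i j)
      = Valued.v ((((GA.mat W a).map (adComponentFin k v) - 1) i j) +
          (1 : Matrix (Fin 4) (Fin 4) (v.adicCompletion k)) i j) := by rw [Matrix.sub_apply, sub_add_cancel]
    _ ≤ max (Valued.v ((((GA.mat W a).map (adComponentFin k v) - 1) i j)))
          (Valued.v ((1 : Matrix (Fin 4) (Fin 4) (v.adicCompletion k)) i j)) := Valuation.map_add _ _ _
    _ ≤ 1 := max_le (h.trans hN) h1

/-- The `v`-component of `ofFinPart g` is that of `g`, matrix form. -/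
theorem map_mat_ofFinPart (g : GA W) :
    (GA.mat W (GA.ofFinPart W g)).map (adComponentFin k v) = (GA.mat W g).map (adComponentFin k v) := by
  rw [← finiteComponent_coe_eq, ← finiteComponent_coe_eq, finiteComponent_ofFinPart]

/-- entrywise bound of a matrix product (ultrametric; `K := k_v`). -/
theorem vmul_apply_le {m n p : Type} [Fintype n] {A : Matrix m n (v.adicCompletion k)}
    {B : Matrix n p (v.adicCompletion k)} {ε ε' : WithZero (Multiplicative ℤ)}
    (hA : ∀ a b, Valued.v (A a b) ≤ ε) (hB : ∀ a b, Valued.v (B a b) ≤ ε') (a : m) (c : p) :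
    Valued.v ((A * B) a c) ≤ ε * ε' := by
  rw [Matrix.mul_apply]
  refine Valuation.map_sum_le _ fun b _ => ?_
  rw [map_mul]
  exact mul_le_mul' (hA a b) (hB b c)

/-- entrywise bound of a sum. -/
theorem vadd_apply_le {m n : Type} {A B : Matrix m n (v.adicCompletion k)} {ε : WithZero (Multiplicative ℤ)}
    (hA : ∀ a b, Valued.v (A a b) ≤ ε) (hB : ∀ a b, Valued.v (B a b) ≤ ε) (a : m) (b : n) :
    Valued.v ((A + B) a b) ≤ ε := by
  rw [Matrix.add_apply]
  exact (Valuation.map_add _ _ _).trans (max_le (hA a b) (hB a b))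

/-- **The double coset is `v`-adically close to `γ₀`**: for `x ∈ K(N) γ₀,f K(N)` and `Γ := (mat γ₀)_v` with entries
`≤ M` (`1 ≤ M`), the entries of `x_v − Γ` are `≤ |N|_v · M`. -/
theorem map_sub_le_of_mem_levelDoubleCoset {N : ℕ} {γ₀ x : GA W}
    (hx : x ∈ levelDoubleCoset W N (GA.ofFinPart W γ₀)) {M : WithZero (Multiplicative ℤ)}
    (hΓ : ∀ i j, Valued.v (((GA.mat W γ₀).map (adComponentFin k v)) i j) ≤ M) (i j : Fin 4) :
    Valued.v (((GA.mat W x).map (adComponentFin k v) - (GA.mat W γ₀).map (adComponentFin k v)) i j) ≤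
      natSize k v N * M := by
  obtain ⟨a, ha, b, hb, rfl⟩ := exists_eq_mul_of_mem_mul_singleton_mul W _ _ _ hx
  set φ := adComponentFin k v with hφ
  set A := (GA.mat W a).map φ with hA
  set B := (GA.mat W b).map φ with hB
  set Γ := (GA.mat W γ₀).map φ with hΓdef
  have hmap : (GA.mat W (a * GA.ofFinPart W γ₀ * b)).map φ = A * Γ * B := by
    rw [GA.mat_mul, GA.mat_mul, Matrix.map_mul, Matrix.map_mul, map_mat_ofFinPart]
  rw [hmap]
  have hid : A * Γ * B - Γ = (A - 1) * Γ * B + Γ * (B - 1) := by noncomm_ring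
  rw [hid]
  have hA1 : ∀ i j, Valued.v ((A - 1) i j) ≤ natSize k v N := fun i j => map_sub_one_le_of_mem_levelK W v ha i j
  have hB1 : ∀ i j, Valued.v ((B - 1) i j) ≤ natSize k v N := fun i j => map_sub_one_le_of_mem_levelK W v hb i j
  have hBle : ∀ i j, Valued.v (B i j) ≤ 1 := fun i j => map_le_one_of_mem_levelK W v hb i j
  refine vadd_apply_le v ?_ ?_ i j
  · intro i j
    calc Valued.v (((A - 1) * Γ * B) i j) ≤ natSize k v N * M * 1 := vmul_apply_le v (vmul_apply_le v hA1 hΓ) hBle i j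
      _ = natSize k v N * M := mul_one _
  · intro i j
    calc Valued.v ((Γ * (B - 1)) i j) ≤ M * natSize k v N := vmul_apply_le v hΓ hB1 i j
      _ = natSize k v N * M := mul_comm _ _

end Bridge


end Summit.Ventures.HodgeRepro.Tier4.Line4
end
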